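import Literature.AlgebraicGeometry.GroupSchemes.HopfIdealOfClosedSubgroup            -- ★ `Alg`, `isHopfIdeal_ker_appTop`, `isAffine_left_of_isClosedImmersion`
import Literature.AlgebraicGeometry.GroupSchemes.BTGroupFrobeniusKernelInCoordinates   -- ★ §4 `map_ker_appTop_kerι_relFrobeniusOver_le` (β-stability, consumed by name)
import HarnessLib

/-!
# The Frobenius-kernel ideal `ker Γ(ι_{Ker F^n})` of an affine group scheme is an ADMISSIBLE Hopf ideal

Topic `Literature/AlgebraicGeometry/GroupSchemes`; namespace `Literature.AlgebraicGeometry.GroupSchemes.FrobKerIdeal`.  THEOREMS ONLY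
(no definition, no instance, no notation, no named fact, no `sorry`).  Cell `hodgecm-mathlib` (D-0151), programme P6 «MOD» (crux hLiu418 =
stmt-HodgeConjecture-24832, `--supports`, count-neutral): DICT-constructor brick **(D2) `stub_K0` «FROB-KERNEL IDEAL ADMISSIBLE»** of the line
`Cruxes/HLiu418/Lines/F0_P6c_DictConstructors.lean` (desk F0P6c-plan (g2), cand v1 eafb617e): with `kerFI p n G := ker Γ(kerι (relFrobeniusOver p n G))`
and `IsAdm G β r I := I.IsHopfIdeal k ∧ finrank k (Γ(G) ⧸ I) = r ∧ ∀ a, I.map Γ(β a) ≤ I`, the stub `IsAdm G β (p^f) (kerFI p f G)` is §3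
`isHopfIdeal_and_finrank_and_map_le` here by ONE `exact` (the rank clause being its hypothesis `hrkF`).  HC_CM is proved only modulo the
printed citations until rung 0 closes; this file is generic and changes no count.

THE PRINT.  [SGA3I] VII_A 4.1: for a group scheme `G` over a field `k` of characteristic `p`, the relative Frobenius `F^n_{G∕k} : G → G^{(p^n)}`
is a homomorphism (★ `Motives.isMonHom_relFrobeniusOver`, transported group structure on the twist, `open scoped Obj`) and its kernel
`Ker F^n ↪ G` is a closed (normal) subgroup scheme, functorial in homomorphisms `φ : G → G'` (`φ(Ker F^n_G) ⊆ Ker F^n_{G'}`).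
[Waterhouse1979] §2.1 ∕ [GortzWedhorn2023] (27.1.1): for `G = Spec A` affine, closed subgroup schemes `K ↪ G` correspond to Hopf ideals
`I = ker (A → Γ(K))` of `A` (★ `isHopfIdeal_ker_appTop`).  [Tate1997FiniteFlatGroupSchemes] (3.7): the finite subgroup schemes of a finite
`k`-group are read on these ideals.  CONSEQUENCE typed here: `ker Γ(ι_{Ker F^n})` is a Hopf ideal of `Γ(G, 𝒪_G)`, stable under `Γ(β a)` for
every family of endomorphisms `β a ∈ End(G)` (the `𝒪_F`-action of the application), of whatever colength `r` one knows (`r = p^n` for a connected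
one-dimensional layer, ★ `finrank_quotient_ker_appTop_kerι_relFrobeniusOver`).

* §1 `isSeparated_frobeniusTwistOver_hom` (the twist of a separated `k`-scheme is separated), **`isClosedImmersion_kerι_relFrobeniusOver_left`**
  for a SEPARATED `G` (★ `BTGroupFrobeniusKernelInCoordinates` has it for `G` finite only), `isAffine_ker_relFrobeniusOver_left`.
* §2 **`isHopfIdeal_ker_appTop_kerι_relFrobeniusOver`** — `ker Γ(ι_{Ker F^n})` is a Hopf ideal of `Alg G = Γ(G, 𝒪_G)` for `G` affine.
* §3 **`isHopfIdeal_and_finrank_and_map_le`** — the admissible triple `IsHopfIdeal ∧ finrank = r ∧ ∀ a, map Γ(β a) ≤` (β-stability = ★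
  `map_ker_appTop_kerι_relFrobeniusOver_le`, consumed by name), and `map_le_of_isMonHom` (stability under ONE endomorphism, same currency).

## References
* [SGA3I] M. Demazure, A. Grothendieck (eds.), *SGA 3, Tome I*, Exp. VII_A §4, 4.1 (relative Frobenius of a group scheme, its kernel).
* [Waterhouse1979] W. C. Waterhouse, *Introduction to Affine Group Schemes*, GTM 66 (1979) — §2.1 (closed subgroups and Hopf ideals).
* [GortzWedhorn2023] U. Görtz, T. Wedhorn, *Algebraic Geometry II* (2023) — (27.1.1), §(27.2) p. 607.
* [GortzWedhorn2020] U. Görtz, T. Wedhorn, *Algebraic Geometry I* (2nd ed. 2020) — Definition 4.45 (2) (p. 117), Section (4.7).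
* [Tate1997FiniteFlatGroupSchemes] J. Tate, *Finite flat group schemes*, in: Modular Forms and Fermat's Last Theorem (1997) — (3.7).
-/

set_option autoImplicit false

-- Mathlib's `Over`/`Scheme` APIs and the transported group structure on the twist are stated across semireducible wrappers
-- (as in ★ `GroupSchemes/*`).
set_option backward.isDefEq.respectTransparency false

noncomputable section

open CategoryTheory CategoryTheory.Limits AlgebraicGeometry MonoidalCategory CartesianMonoidalCategory

open scoped MonObj Obj

universe u

namespace Literature.AlgebraicGeometry.GroupSchemes.FrobKerIdeal

open Literature.AlgebraicGeometry.Motives GroupSchemeKernel AffineGroupScheme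

variable {k : Type u} [Field k] (p : ℕ) [ExpChar k p] (n : ℕ) (G : SchemeOver k)

/-! ## §1 The kernel of the relative Frobenius of a separated (e.g. affine) group scheme is a closed subscheme -/

/-- The Frobenius twist `G^{(p^n)} → Spec k` of a separated `k`-scheme is separated (base change of `G → Spec k` along `Spec Frob^n`).
[cite: GortzWedhorn2020, Section (4.7)] -/
theorem isSeparated_frobeniusTwistOver_hom [IsSeparated G.hom] : IsSeparated (frobeniusTwistOver p n G).hom := by
  rw [frobeniusTwistOver_hom, twistSnd_def]
  infer_instance

variable [GrpObj G]

/-- **`Ker F^n_{G∕k} ↪ G` is a CLOSED IMMERSION** for every separated `k`-group scheme `G` (the unit section of the separated twist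
`G^{(p^n)}` is a closed immersion, ★ `isClosedImmersion_kerι_left_of_isSeparated`; ★ `BTGroupFrobeniusKernelInCoordinates` states the
finite case). [cite: SGA3I, VII_A 4.1] [cite: GortzWedhorn2020, Definition 4.45 (2) (p. 117)] -/
theorem isClosedImmersion_kerι_relFrobeniusOver_left [IsSeparated G.hom] :
    IsClosedImmersion (kerι (relFrobeniusOver p n G)).left := by
  haveI := isSeparated_frobeniusTwistOver_hom p n G
  exact isClosedImmersion_kerι_left_of_isSeparated _

/-- `Ker F^n_{G∕k}` is an affine scheme when `G` is affine (a closed subscheme of `G`). [cite: GortzWedhorn2023, §(27.2) (p. 607)] -/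
theorem isAffine_ker_relFrobeniusOver_left [IsAffine G.left] : IsAffine (ker (relFrobeniusOver p n G)).left := by
  haveI := isClosedImmersion_kerι_relFrobeniusOver_left p n G
  exact isAffine_left_of_isClosedImmersion (kerι (relFrobeniusOver p n G))

/-! ## §2 `ker Γ(ι_{Ker F^n})` is a Hopf ideal of `Γ(G, 𝒪_G)` -/

/-- **The Frobenius-kernel ideal is a HOPF IDEAL**: for an affine `k`-group scheme `G`, the kernel of
`Γ(ι) : Γ(G, 𝒪_G) → Γ(Ker F^n, 𝒪)` (the ideal of the closed subgroup scheme `Ker F^n_{G∕k} ↪ G`, `F^n_{G∕k}` a homomorphism ★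
`Motives.isMonHom_relFrobeniusOver`, `ι` a homomorphic closed immersion ★ `isMonHom_kerι`) is a Hopf ideal of the Hopf algebra `Alg G`
(★ `isHopfIdeal_ker_appTop`). [cite: SGA3I, VII_A 4.1] [cite: Waterhouse1979, §2.1] [cite: GortzWedhorn2023, (27.1.1) and §(27.2) (p. 607)] -/
theorem isHopfIdeal_ker_appTop_kerι_relFrobeniusOver [IsAffine G.left] :
    (RingHom.ker (kerι (relFrobeniusOver p n G)).left.appTop.hom : Ideal (Alg G)).IsHopfIdeal k := by
  haveI := isMonHom_relFrobeniusOver p n G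
  haveI := isClosedImmersion_kerι_relFrobeniusOver_left p n G
  haveI := isAffine_ker_relFrobeniusOver_left p n G
  exact isHopfIdeal_ker_appTop (kerι (relFrobeniusOver p n G))

/-! ## §3 The admissible triple: Hopf, of the given colength, stable under a family of endomorphisms -/

variable {G} in
/-- **β-STABILITY under one endomorphism** (★ `map_ker_appTop_kerι_relFrobeniusOver_le` at `G' = G`, restated in the `Ideal (Alg G)`
currency of the admissible-ideal carrier): for a homomorphism `b : G → G`, `Γ(b)` maps `ker Γ(ι_{Ker F^n})` into itself (`b` restricts to
`Ker F^n_G → Ker F^n_G` by functoriality of `F^n_{G∕k}`). [cite: SGA3I, VII_A 4.1] [cite: GortzWedhorn2020, Definition 4.45 (2) (p. 117)] -/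
theorem map_le_of_isMonHom (b : G ⟶ G) [IsMonHom b] :
    (RingHom.ker (kerι (relFrobeniusOver p n G)).left.appTop.hom : Ideal (Alg G)).map b.left.appTop.hom ≤
      (RingHom.ker (kerι (relFrobeniusOver p n G)).left.appTop.hom : Ideal (Alg G)) :=
  map_ker_appTop_kerι_relFrobeniusOver_le p n b

variable {G} in
/-- **The Frobenius-kernel ideal is ADMISSIBLE** — the triple «Hopf ideal ∧ colength `r` ∧ stable under every `Γ(β a)`» for an affine
`k`-group scheme `G` with a family of endomorphisms `β a ∈ End(G)` (an `𝒪`-action), the colength `r` of `ker Γ(ι_{Ker F^n})` being GIVEN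
(`r = p^n` on a connected one-dimensional layer, ★ `finrank_quotient_ker_appTop_kerι_relFrobeniusOver`): §2 + ★
`map_ker_appTop_kerι_relFrobeniusOver_le`.  This is `IsAdm G β r (kerFI p n G)` of the DICT-constructor line, unfolded.
[cite: SGA3I, VII_A 4.1] [cite: Tate1997FiniteFlatGroupSchemes, (3.7)] [cite: Waterhouse1979, §2.1] -/
theorem isHopfIdeal_and_finrank_and_map_le [IsAffine G.left] {σ : Type*} (β : σ → (G ⟶ G)) (hβ : ∀ a, IsMonHom (β a)) {r : ℕ}
    (hrk : Module.finrank k (Alg G ⧸ (RingHom.ker (kerι (relFrobeniusOver p n G)).left.appTop.hom : Ideal (Alg G))) = r) :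
    (RingHom.ker (kerι (relFrobeniusOver p n G)).left.appTop.hom : Ideal (Alg G)).IsHopfIdeal k ∧
      Module.finrank k (Alg G ⧸ (RingHom.ker (kerι (relFrobeniusOver p n G)).left.appTop.hom : Ideal (Alg G))) = r ∧
      ∀ a : σ, (RingHom.ker (kerι (relFrobeniusOver p n G)).left.appTop.hom : Ideal (Alg G)).map (β a).left.appTop.hom ≤
        (RingHom.ker (kerι (relFrobeniusOver p n G)).left.appTop.hom : Ideal (Alg G)) :=
  ⟨isHopfIdeal_ker_appTop_kerι_relFrobeniusOver p n G, hrk, fun a => by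
    haveI := hβ a
    exact map_le_of_isMonHom p n (β a)⟩

end Literature.AlgebraicGeometry.GroupSchemes.FrobKerIdeal

end
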